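import Literature.Topology.FourManifolds.TautFoliationsCollarRingCompact
import HarnessLib

/-!
# A generic radius for the wiggly rings, and the compact contour leaf of the coned collar

Sibling of `TautFoliationsCollarRingCompact.lean`. For a mesh `≥ 128` there is a radius
`R ∈ [15L/16, 31L/32]` at which no grid vertex lies (finitely many vertices, an interval of
radii) and with `R + 2ℓ < L`; at such a radius the leaf of the contour foliation through any ring
point of the 1-skeleton is compact. Packaged: **the coned fence collar (mesh `≥ 128`) has a
compact leaf of its contour foliation through a ring point of an edge**
(`exists_isCompact_leaf_collar`).

* `exists_generic_radius`, `exists_isCompact_leaf_collar` (**proved**).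

All statements are [folklore].
-/

noncomputable section

open Set Filter Metric Topology Function Real
open scoped unitInterval
open Literature.Topology.PlanarFoliations

namespace Literature.Topology.FourManifolds

namespace Foliation.ConePosition

open SquareGrid SquareGrid.Grid SquarePolar ConeSquare CollarRadius

variable {B : Type*} [NormedAddCommGroup B] [NormedSpace ℝ B] {M : Type*} [TopologicalSpace M] {F : Foliation B M}
variable {Γ : C(I, F.GermSpace)} {τ₀ ε : ℝ} {Φ : I → ℝ → M} {c₀ : ℝ × ℝ} {L : ℝ} {hL : 0 < L} {G : ℝ × ℝ → M}
variable (P : ConePosition F G c₀ hL)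

omit [NormedSpace ℝ B] in
/-- **A generic radius**: in `[15L/16, 31L/32]`, at the distance of no vertex, and with
`R + 2ℓ < L` when the mesh is at least `128`. [folklore] -/
theorem exists_generic_radius (hn : 128 ≤ P.n) :
    ∃ R, 15 * L / 16 ≤ R ∧ R ≤ 31 * L / 32 ∧ (∀ v ∈ P.gr.vertices, dist v c₀ ≠ R) ∧ R + 2 * P.gr.ℓ < L := by
  have hℓ : P.gr.ℓ = L / P.n := grid_ℓ hL P.hn
  have hn' : (128 : ℝ) ≤ P.n := by exact_mod_cast hn
  have hℓle : P.gr.ℓ ≤ L / 128 := by rw [hℓ]; exact div_le_div_of_nonneg_left hL.le (by norm_num) hn'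
  -- the bad radii are finitely many
  have hfin : ((fun v : ℝ × ℝ ↦ dist v c₀) '' P.gr.vertices).Finite := P.gr.finite_vertices.image _
  have hinf : (Ioo (15 * L / 16) (31 * L / 32)).Infinite := Ioo_infinite (by linarith)
  obtain ⟨R, hRI, hRnot⟩ := (hinf.sdiff hfin).nonempty
  refine ⟨R, hRI.1.le, hRI.2.le, fun v hv h ↦ hRnot ⟨v, hv, h⟩, ?_⟩
  linarith [hRI.2]

/-- **The coned fence collar has a compact contour leaf through a ring point of an edge.** For a
cone position of the collar disc with mesh `≥ 128` keeping the disc map on the outer-collar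
edges, there are a generic radius `R` and a point `y₀` of the carrier on the boundary of a grid
square at distance `R` from `c₀` (a point of the wiggly ring `W_R`) whose leaf is compact and
contained in `W_R`. [folklore] -/
theorem exists_isCompact_leaf_collar (ho : F.IsTransverselyOriented)
    (hΦ : IsFenceOn F Γ τ₀ ε Φ univ) (hcl : ∀ τ ∈ Ioo (τ₀ - ε) (τ₀ + ε), Φ 1 τ = Φ 0 τ) {τ₁ : ℝ}
    (hτI : uIcc τ₀ τ₁ ⊆ Ioo (τ₀ - ε) (τ₀ + ε)) (h01 : τ₁ ≠ τ₀)
    (hG : ∀ x, L / 2 ≤ dist x c₀ → G x = Φ (angleParam c₀ x) (levelOfParam τ₀ τ₁ (1 - dist x c₀ / L)))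
    (hGc : Continuous G) (hn : 128 ≤ P.n)
    (hskelT : ∀ q k, P.gr.edge q k '' Icc 0 (2 * P.gr.ℓ) ⊆ {x | 7 * L / 8 ≤ dist x c₀} →
      ∀ s ∈ Icc 0 (2 * P.gr.ℓ), P.skel (P.gr.edge q k s) = G (P.gr.edge q k s)) :
    ∃ (R : ℝ) (y₀ : P.gr.X₀), 15 * L / 16 ≤ R ∧ R + 2 * P.gr.ℓ < L ∧ (∀ v ∈ P.gr.vertices, dist v c₀ ≠ R) ∧
      dist (y₀ : ℝ × ℝ) c₀ = R ∧ (∃ q, (y₀ : ℝ × ℝ) ∈ sphere (P.gr.centre q) P.gr.ℓ) ∧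
      (y₀ : ℝ × ℝ) ∈ P.wigglyRing R ∧ IsCompact ((P.contourFol ho).leaf y₀) ∧
      ∀ z ∈ (P.contourFol ho).leaf y₀, (z : ℝ × ℝ) ∈ P.wigglyRing R := by
  have hn32 : 32 ≤ P.n := le_trans (by norm_num) hn
  obtain ⟨R, hR, hR', hvert, hRL⟩ := P.exists_generic_radius hn
  -- a square meeting the ring: the square of any ring point, e.g. the ray point at radius `R` of a corner? use the point `c₀ + (R, 0)`
  set x₀ : ℝ × ℝ := c₀ + ((R, 0) : ℝ × ℝ) with hx₀
  have hR0 : 0 < R := by linarith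
  have hx₀R : dist x₀ c₀ = R := by
    rw [Prod.dist_eq, hx₀, Real.dist_eq, Real.dist_eq]
    simp only [Prod.fst_add, Prod.snd_add, add_sub_cancel_left, add_zero, sub_self, abs_zero]
    rw [abs_of_pos hR0]; exact max_eq_left hR0.le
  have hx₀S : x₀ ∈ P.gr.S := by
    rw [show P.gr.S = closedBall c₀ L from grid_S hL P.hn, mem_closedBall, hx₀R]; linarith
  obtain ⟨q, hq⟩ := P.gr.exists_mem_sq hx₀S
  have hqR : (P.gr.sq q ∩ sphere c₀ R).Nonempty := ⟨x₀, hq, mem_sphere.2 hx₀R⟩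
  -- a ring point of the boundary of `q`
  obtain ⟨y, hys, hyR⟩ := P.exists_mem_sphere_ring hn32 hR hqR
  have hyW : y ∈ P.wigglyRing R := P.mem_wigglyRing_of_mem_sphere hΦ hcl hτI h01 hG hGc hn32 hskelT hR hys hyR
  have hyX : y ∈ (P.gr.X₀ : Set (ℝ × ℝ)) := P.wigglyRing_subset_X₀ hΦ hcl hτI h01 hG hGc hn32 hskelT hR hvert hRL y hyW
  refine ⟨R, ⟨y, hyX⟩, hR, hRL, hvert, hyR, ⟨q, hys⟩, hyW, ?_, ?_⟩
  · exact P.isCompact_leaf_of_mem_wigglyRing hΦ hcl hτI h01 hG hGc hn32 hskelT hR ho hvert hRL ⟨y, hyX⟩ hyW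
  · exact P.leaf_subset_wigglyRing hΦ hcl hτI h01 hG hGc hn32 hskelT hR ho hyW

end Foliation.ConePosition

end Literature.Topology.FourManifolds
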